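import Mathlib.LinearAlgebra.Matrix.Rank
import Mathlib.Data.Matrix.Mul
import Literature.Computability.AlgebraicComplexity.MignonRessayreBound
import HarnessLib

/-!
# Block eigenvectors of the Hessian of the permanent at block-constant points

Helper file for the crux `HessianRankCodimTwo` (stmt-ValiantsHypothesis-8061, route `GrenetZeon`),
line `good_plane` (`Cruxes/HessianRankCodimTwo/Lines/good_plane.lean`, stub `stub_goodPlanes`).

The engine of every *block-constant* candidate for a good plane: if the point `x ∈ ℂ^{n × n}` has
identical rows on an index set `I` and identical columns on an index set `J`, then every matrix
`X` supported in `I × J` with zero row sums and zero column sums is an EIGENVECTOR of the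
`n² × n²` Hessian `H(x) = hess0 (transl x per_n)` of the permanent at `x`, with eigenvalue the
common value `h_{IJ}` of the Hessian entries `H(x)_{(i₀,j₀),(i₁,j₁)}` (`i₀ ≠ i₁ ∈ I`,
`j₀ ≠ j₁ ∈ J`), i.e. the `(n-2) × (n-2)` sub-permanent of `x` with two rows of `I` and two
columns of `J` removed (`hessPer_mulVec_eq_smul`).  Consequently (`le_rank_hessPer_of_blocks`)
`rank H(x) ≥ Σ_t (|I_t| - 1)(|J_t| - 1)` over any family of blocks `I_t × J_t` with pairwise
disjoint supports and non-zero block values `h_t`.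

Ingredients: the sub-permanent formula `hess0_transl_perPoly` (tree, `MignonRessayreBound.lean`)
and two symmetry lemmas (`hessPer_apply_perm_rows`, `hessPer_apply_perm_cols`): a permutation of
the rows (columns) of `x` preserving `x` acts on the Hessian entries by relabelling.
-/

noncomputable section

open Matrix Finset MvPolynomial
open Literature.Computability.AlgebraicComplexity

set_option linter.dupNamespace false

namespace Summit.ValiantsHypothesis.ValiantsHypothesis.Theorems.GrenetZeonHessianRankCodimTwo

variable {k : Type*} [CommRing k] {n : ℕ}

/-! ### Vanishing and symmetry of the Hessian entries -/

/-- Hessian entries `((c,d),(a,b))` of the permanent with `d = b` (same column) vanish. [folklore] -/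
theorem hessPer_apply_eq_zero_of_snd_eq (x : Fin n × Fin n → k) {a b c d : Fin n} (h : d = b) :
    hess0 (transl x (perPoly (Fin n) k)) (c, d) (a, b) = 0 := by
  rw [hess0_transl_perPoly]
  exact Finset.sum_eq_zero fun π _ => if_neg fun hc => hc.2.1 h

/-- Hessian entries `((c,d),(a,b))` of the permanent with `c = a` (same row) vanish. [folklore] -/
theorem hessPer_apply_eq_zero_of_fst_eq (x : Fin n × Fin n → k) {a b c d : Fin n} (h : c = a) :
    hess0 (transl x (perPoly (Fin n) k)) (c, d) (a, b) = 0 := by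
  rw [hess0_transl_perPoly]
  refine Finset.sum_eq_zero fun π _ => if_neg ?_
  rintro ⟨hb, hdb, hd⟩
  apply hdb
  apply π.injective
  rw [hb, hd, h]

/-- A permutation `σ` of the row indices preserving the point `x` (e.g. a permutation of a set of
identical rows) relabels the Hessian entries: `H_{(σ c, d),(σ a, b)} = H_{(c,d),(a,b)}`. [folklore] -/
theorem hessPer_apply_perm_rows (x : Fin n × Fin n → k) (σ : Equiv.Perm (Fin n))
    (hσ : ∀ r j, x (σ r, j) = x (r, j)) (a b c d : Fin n) :
    hess0 (transl x (perPoly (Fin n) k)) (σ c, d) (σ a, b) =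
      hess0 (transl x (perPoly (Fin n) k)) (c, d) (a, b) := by
  rw [hess0_transl_perPoly, hess0_transl_perPoly]
  refine (Fintype.sum_equiv (Equiv.mulLeft σ) _ _ fun π => ?_).symm
  simp only [Equiv.coe_mulLeft, Equiv.Perm.mul_apply, hσ, EmbeddingLike.apply_eq_iff_eq]

/-- A permutation `τ` of the column indices preserving the point `x` relabels the Hessian entries:
`H_{(c, τ d),(a, τ b)} = H_{(c,d),(a,b)}`. [folklore] -/
theorem hessPer_apply_perm_cols (x : Fin n × Fin n → k) (τ : Equiv.Perm (Fin n))
    (hτ : ∀ r j, x (r, τ j) = x (r, j)) (a b c d : Fin n) :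
    hess0 (transl x (perPoly (Fin n) k)) (c, τ d) (a, τ b) =
      hess0 (transl x (perPoly (Fin n) k)) (c, d) (a, b) := by
  rw [hess0_transl_perPoly, hess0_transl_perPoly]
  refine Fintype.sum_equiv (Equiv.mulRight τ) _ _ fun π => ?_
  have hprod : ∏ i ∈ (univ.erase b).erase d, x (π (τ i), i) =
      ∏ i ∈ (univ.erase (τ b)).erase (τ d), x (π i, i) := by
    refine Finset.prod_equiv τ (fun i => ?_) (fun i _ => ?_)
    · simp only [Finset.mem_erase, Finset.mem_univ, and_true, ne_eq,
        EmbeddingLike.apply_eq_iff_eq]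
    · rw [hτ]
  simp only [Equiv.coe_mulRight, Equiv.Perm.mul_apply, ne_eq, EmbeddingLike.apply_eq_iff_eq]
  rw [hprod]

/-- **Block constancy.** If the rows of `x` indexed by `I` coincide and the columns indexed by `J`
coincide, all Hessian entries `((c,d),(a,b))` with `c ≠ a` in `I` and `d ≠ b` in `J` are equal
(to the sub-permanent of `x` with two rows of `I` and two columns of `J` removed). [folklore] -/
theorem hessPer_apply_block (x : Fin n × Fin n → k) {I J : Finset (Fin n)}
    (hI : ∀ i ∈ I, ∀ i' ∈ I, ∀ j, x (i, j) = x (i', j))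
    (hJ : ∀ j ∈ J, ∀ j' ∈ J, ∀ i, x (i, j) = x (i, j'))
    {a b c d i₀ i₁ j₀ j₁ : Fin n} (hc : c ∈ I) (ha : a ∈ I) (hca : c ≠ a)
    (hd : d ∈ J) (hb : b ∈ J) (hdb : d ≠ b)
    (hi₀ : i₀ ∈ I) (hi₁ : i₁ ∈ I) (hi : i₀ ≠ i₁) (hj₀ : j₀ ∈ J) (hj₁ : j₁ ∈ J) (hj : j₀ ≠ j₁) :
    hess0 (transl x (perPoly (Fin n) k)) (c, d) (a, b) =
      hess0 (transl x (perPoly (Fin n) k)) (i₀, j₀) (i₁, j₁) := by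
  have hswI : ∀ {u v : Fin n}, u ∈ I → v ∈ I → ∀ r j, x (Equiv.swap u v r, j) = x (r, j) := by
    intro u v hu hv r j
    rcases eq_or_ne r u with rfl | hru
    · rw [Equiv.swap_apply_left, hI v hv r hu]
    rcases eq_or_ne r v with rfl | hrv
    · rw [Equiv.swap_apply_right, hI u hu r hv]
    · rw [Equiv.swap_apply_of_ne_of_ne hru hrv]
  have hswJ : ∀ {u v : Fin n}, u ∈ J → v ∈ J → ∀ r j, x (r, Equiv.swap u v j) = x (r, j) := by
    intro u v hu hv r j
    rcases eq_or_ne j u with rfl | hju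
    · rw [Equiv.swap_apply_left, hJ v hv j hu]
    rcases eq_or_ne j v with rfl | hjv
    · rw [Equiv.swap_apply_right, hJ u hu j hv]
    · rw [Equiv.swap_apply_of_ne_of_ne hju hjv]
  set a' := Equiv.swap c i₀ a with ha'
  have ha'I : a' ∈ I := by
    rw [ha']
    rcases eq_or_ne a c with rfl | hac
    · rwa [Equiv.swap_apply_left]
    rcases eq_or_ne a i₀ with rfl | hai
    · rwa [Equiv.swap_apply_right]
    · rwa [Equiv.swap_apply_of_ne_of_ne hac hai]
  have ha'i₀ : a' ≠ i₀ := by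
    rw [ha']
    intro h
    have : a = (Equiv.swap c i₀).symm i₀ := (Equiv.apply_eq_iff_eq_symm_apply _).mp h
    rw [Equiv.symm_swap, Equiv.swap_apply_right] at this
    exact hca this.symm
  have step1 : hess0 (transl x (perPoly (Fin n) k)) (c, d) (a, b) =
      hess0 (transl x (perPoly (Fin n) k)) (i₀, d) (a', b) := by
    have := hessPer_apply_perm_rows x (Equiv.swap c i₀) (hswI hc hi₀) a b c d
    rw [Equiv.swap_apply_left] at this
    rw [← this]
  have step2 : hess0 (transl x (perPoly (Fin n) k)) (i₀, d) (a', b) =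
      hess0 (transl x (perPoly (Fin n) k)) (i₀, d) (i₁, b) := by
    have := hessPer_apply_perm_rows x (Equiv.swap a' i₁) (hswI ha'I hi₁) a' b i₀ d
    rw [Equiv.swap_apply_left, Equiv.swap_apply_of_ne_of_ne ha'i₀.symm hi] at this
    rw [← this]
  set b' := Equiv.swap d j₀ b with hb'
  have hb'J : b' ∈ J := by
    rw [hb']
    rcases eq_or_ne b d with rfl | hbd
    · rwa [Equiv.swap_apply_left]
    rcases eq_or_ne b j₀ with rfl | hbj
    · rwa [Equiv.swap_apply_right]
    · rwa [Equiv.swap_apply_of_ne_of_ne hbd hbj]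
  have hb'j₀ : b' ≠ j₀ := by
    rw [hb']
    intro h
    have : b = (Equiv.swap d j₀).symm j₀ := (Equiv.apply_eq_iff_eq_symm_apply _).mp h
    rw [Equiv.symm_swap, Equiv.swap_apply_right] at this
    exact hdb this.symm
  have step3 : hess0 (transl x (perPoly (Fin n) k)) (i₀, d) (i₁, b) =
      hess0 (transl x (perPoly (Fin n) k)) (i₀, j₀) (i₁, b') := by
    have := hessPer_apply_perm_cols x (Equiv.swap d j₀) (hswJ hd hj₀) i₁ b i₀ d
    rw [Equiv.swap_apply_left] at this
    rw [← this]
  have step4 : hess0 (transl x (perPoly (Fin n) k)) (i₀, j₀) (i₁, b') =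
      hess0 (transl x (perPoly (Fin n) k)) (i₀, j₀) (i₁, j₁) := by
    have := hessPer_apply_perm_cols x (Equiv.swap b' j₁) (hswJ hb'J hj₁) i₁ b' i₀ j₀
    rw [Equiv.swap_apply_left, Equiv.swap_apply_of_ne_of_ne hb'j₀.symm hj] at this
    rw [← this]
  rw [step1, step2, step3, step4]

/-! ### The block eigenvector theorem -/

/-- **Block eigenvectors of the Hessian of the permanent.** If the rows of the point `x` indexed by
`I` coincide and its columns indexed by `J` coincide, then every `X` supported in `I × J` with zero
row sums and zero column sums satisfies `H(x) X = h_{IJ} X`, where `h_{IJ}` is the common value of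
the Hessian entries `((i₀,j₀),(i₁,j₁))`, `i₀ ≠ i₁ ∈ I`, `j₀ ≠ j₁ ∈ J`. [folklore] -/
theorem hessPer_mulVec_eq_smul (x : Fin n × Fin n → k) {I J : Finset (Fin n)}
    (hI : ∀ i ∈ I, ∀ i' ∈ I, ∀ j, x (i, j) = x (i', j))
    (hJ : ∀ j ∈ J, ∀ j' ∈ J, ∀ i, x (i, j) = x (i, j'))
    {X : Fin n × Fin n → k} (hX : ∀ p, X p ≠ 0 → p.1 ∈ I ∧ p.2 ∈ J)
    (hrow : ∀ i, ∑ j, X (i, j) = 0) (hcol : ∀ j, ∑ i, X (i, j) = 0)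
    {i₀ i₁ j₀ j₁ : Fin n} (hi₀ : i₀ ∈ I) (hi₁ : i₁ ∈ I) (hi : i₀ ≠ i₁)
    (hj₀ : j₀ ∈ J) (hj₁ : j₁ ∈ J) (hj : j₀ ≠ j₁) :
    hess0 (transl x (perPoly (Fin n) k)) *ᵥ X =
      hess0 (transl x (perPoly (Fin n) k)) (i₀, j₀) (i₁, j₁) • X := by
  set H := hess0 (transl x (perPoly (Fin n) k)) with hH
  have hX0 : ∀ a b, ¬ (a ∈ I ∧ b ∈ J) → X (a, b) = 0 := fun a b h => by
    by_contra hne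
    exact h (hX (a, b) hne)
  ext ⟨c, d⟩
  simp only [Matrix.mulVec, dotProduct, Pi.smul_apply, smul_eq_mul]
  rw [Fintype.sum_prod_type]
  by_cases hc : c ∈ I
  · by_cases hd : d ∈ J
    · -- the diagonal block: `Σ_{a ≠ c} Σ_{b ≠ d} h X(a,b) = h X(c,d)`
      have h0 : ∀ a, H (c, d) (a, d) * X (a, d) = 0 := fun a => by
        rw [hH, hessPer_apply_eq_zero_of_snd_eq x rfl, zero_mul]
      have hval : ∀ a ∈ univ.erase c, ∀ b ∈ univ.erase d,
          H (c, d) (a, b) * X (a, b) = H (i₀, j₀) (i₁, j₁) * X (a, b) := by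
        intro a ha b hb
        by_cases hXab : X (a, b) = 0
        · rw [hXab, mul_zero, mul_zero]
        · obtain ⟨haI, hbJ⟩ := hX (a, b) hXab
          rw [hH, hessPer_apply_block x hI hJ hc haI (Finset.ne_of_mem_erase ha).symm hd hbJ
            (Finset.ne_of_mem_erase hb).symm hi₀ hi₁ hi hj₀ hj₁ hj]
      calc ∑ a, ∑ b, H (c, d) (a, b) * X (a, b)
          = ∑ a ∈ univ.erase c, ∑ b, H (c, d) (a, b) * X (a, b) := by
            rw [← Finset.sum_erase_add _ _ (Finset.mem_univ c)]
            have : ∑ b, H (c, d) (c, b) * X (c, b) = 0 := Finset.sum_eq_zero fun b _ => by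
              rw [hH, hessPer_apply_eq_zero_of_fst_eq x rfl, zero_mul]
            rw [this, add_zero]
        _ = ∑ a ∈ univ.erase c, ∑ b ∈ univ.erase d, H (i₀, j₀) (i₁, j₁) * X (a, b) := by
            refine Finset.sum_congr rfl fun a ha => ?_
            rw [← Finset.sum_erase_add _ _ (Finset.mem_univ d), h0 a, add_zero]
            exact Finset.sum_congr rfl fun b hb => hval a ha b hb
        _ = H (i₀, j₀) (i₁, j₁) * ∑ a ∈ univ.erase c, ∑ b ∈ univ.erase d, X (a, b) := by
            rw [Finset.mul_sum]
            exact Finset.sum_congr rfl fun a _ => (Finset.mul_sum _ _ _).symm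
        _ = H (i₀, j₀) (i₁, j₁) * X (c, d) := by
            congr 1
            have hb : ∀ a, ∑ b ∈ univ.erase d, X (a, b) = -X (a, d) := fun a => by
              rw [Finset.sum_erase_eq_sub (Finset.mem_univ d), hrow, zero_sub]
            rw [Finset.sum_congr rfl fun a _ => hb a, Finset.sum_neg_distrib,
              Finset.sum_erase_eq_sub (Finset.mem_univ c), hcol, zero_sub, neg_neg]
    · -- `c ∈ I`, `d ∉ J`: `X(c,d) = 0`; entries constant along `b ∈ J`
      rw [hX0 c d (fun h => hd h.2), mul_zero]
      refine Finset.sum_eq_zero fun a _ => ?_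
      have hterm : ∀ b, H (c, d) (a, b) * X (a, b) = H (c, d) (a, j₀) * X (a, b) := by
        intro b
        by_cases hXab : X (a, b) = 0
        · rw [hXab, mul_zero, mul_zero]
        · obtain ⟨-, hb⟩ := hX (a, b) hXab
          have hbd : b ≠ d := fun h => hd (h ▸ hb)
          have hjd : j₀ ≠ d := fun h => hd (h ▸ hj₀)
          have hsw : ∀ r j, x (r, Equiv.swap b j₀ j) = x (r, j) := by
            intro r j
            rcases eq_or_ne j b with rfl | hjb
            · rw [Equiv.swap_apply_left, hJ j₀ hj₀ j hb]
            rcases eq_or_ne j j₀ with rfl | hjj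
            · rw [Equiv.swap_apply_right, hJ b hb j hj₀]
            · rw [Equiv.swap_apply_of_ne_of_ne hjb hjj]
          have := hessPer_apply_perm_cols x (Equiv.swap b j₀) hsw a b c d
          rw [Equiv.swap_apply_left, Equiv.swap_apply_of_ne_of_ne hbd.symm hjd.symm] at this
          rw [hH, this]
      rw [Finset.sum_congr rfl fun b _ => hterm b, ← Finset.mul_sum, hrow, mul_zero]
  · -- `c ∉ I`: `X(c,d) = 0`; entries constant along `a ∈ I`
    rw [hX0 c d (fun h => hc h.1), mul_zero, Finset.sum_comm]
    refine Finset.sum_eq_zero fun b _ => ?_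
    have hterm : ∀ a, H (c, d) (a, b) * X (a, b) = H (c, d) (i₀, b) * X (a, b) := by
      intro a
      by_cases hXab : X (a, b) = 0
      · rw [hXab, mul_zero, mul_zero]
      · obtain ⟨ha, -⟩ := hX (a, b) hXab
        have hac : a ≠ c := fun h => hc (h ▸ ha)
        have hic : i₀ ≠ c := fun h => hc (h ▸ hi₀)
        have hsw : ∀ r j, x (Equiv.swap a i₀ r, j) = x (r, j) := by
          intro r j
          rcases eq_or_ne r a with rfl | hra
          · rw [Equiv.swap_apply_left, hI i₀ hi₀ r ha]
          rcases eq_or_ne r i₀ with rfl | hri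
          · rw [Equiv.swap_apply_right, hI a ha r hi₀]
          · rw [Equiv.swap_apply_of_ne_of_ne hra hri]
        have := hessPer_apply_perm_rows x (Equiv.swap a i₀) hsw a b c d
        rw [Equiv.swap_apply_left, Equiv.swap_apply_of_ne_of_ne hac.symm hic.symm] at this
        rw [hH, this]
    rw [Finset.sum_congr rfl fun a _ => hterm a, ← Finset.mul_sum, hcol, mul_zero]

/-! ### Rank lower bound from a family of blocks -/

section Rank

variable {K : Type*} [Field K]

/-- **Rank of the Hessian of the permanent at a block-constant point.** Let `I_t × J_t`
(`t : ι`) be blocks with pairwise disjoint supports such that the rows of `x` indexed by each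
`I_t` coincide and the columns indexed by each `J_t` coincide, and suppose every block value
`h_t = H(x)_{(i₀ t, j₀ t),(i₁ t, j₁ t)}` (`i₀ t ≠ i₁ t ∈ I_t`, `j₀ t ≠ j₁ t ∈ J_t`) is non-zero.
Then `rank H(x) ≥ Σ_t (|I_t| - 1)(|J_t| - 1)`: the vectors `(e_a - e_{i₀ t}) ⊗ (e_b - e_{j₀ t})`,
`a ∈ I_t ∖ i₀ t`, `b ∈ J_t ∖ j₀ t`, are linearly independent eigenvectors with non-zero
eigenvalues. [folklore] -/
theorem le_rank_hessPer_of_blocks {ι : Type*} [Fintype ι]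
    (x : Fin n × Fin n → K) (I J : ι → Finset (Fin n))
    (hI : ∀ t, ∀ i ∈ I t, ∀ i' ∈ I t, ∀ j, x (i, j) = x (i', j))
    (hJ : ∀ t, ∀ j ∈ J t, ∀ j' ∈ J t, ∀ i, x (i, j) = x (i, j'))
    (hdisj : ∀ t t' (p : Fin n × Fin n), p.1 ∈ I t → p.2 ∈ J t → p.1 ∈ I t' → p.2 ∈ J t' →
      t = t')
    (i₀ i₁ j₀ j₁ : ι → Fin n) (hi₀ : ∀ t, i₀ t ∈ I t) (hi₁ : ∀ t, i₁ t ∈ I t)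
    (hi : ∀ t, i₀ t ≠ i₁ t) (hj₀ : ∀ t, j₀ t ∈ J t) (hj₁ : ∀ t, j₁ t ∈ J t)
    (hj : ∀ t, j₀ t ≠ j₁ t)
    (hh : ∀ t, hess0 (transl x (perPoly (Fin n) K)) (i₀ t, j₀ t) (i₁ t, j₁ t) ≠ 0) :
    ∑ t, ((I t).card - 1) * ((J t).card - 1) ≤ (hess0 (transl x (perPoly (Fin n) K))).rank := by
  classical
  set H := hess0 (transl x (perPoly (Fin n) K)) with hH
  set S : Finset (Σ _ : ι, Fin n × Fin n) :=
    Finset.univ.sigma fun t => ((I t).erase (i₀ t)) ×ˢ ((J t).erase (j₀ t)) with hS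
  have hcard : S.card = ∑ t, ((I t).card - 1) * ((J t).card - 1) := by
    rw [hS, Finset.card_sigma]
    refine Finset.sum_congr rfl fun t _ => ?_
    rw [Finset.card_product, Finset.card_erase_of_mem (hi₀ t), Finset.card_erase_of_mem (hj₀ t)]
  have hmem : ∀ σ : S, σ.1.2.1 ∈ I σ.1.1 ∧ σ.1.2.1 ≠ i₀ σ.1.1 ∧
      σ.1.2.2 ∈ J σ.1.1 ∧ σ.1.2.2 ≠ j₀ σ.1.1 := by
    intro σ
    have := σ.2
    simp only [hS, Finset.mem_sigma, Finset.mem_univ, true_and, Finset.mem_product,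
      Finset.mem_erase] at this
    exact ⟨this.1.2, this.1.1, this.2.2, this.2.1⟩
  -- the test matrix: column `σ = ⟨t, a, b⟩` is `(e_a - e_{i₀ t}) ⊗ (e_b - e_{j₀ t})`
  set δ : Fin n → Fin n → K := fun r u => if r = u then 1 else 0 with hδ
  have hδsum : ∀ u : Fin n, ∑ s, δ s u = 1 := fun u => by
    simp only [hδ, Finset.sum_ite_eq', Finset.mem_univ, if_true]
  have hδ_of_ne : ∀ {r u : Fin n}, r ≠ u → δ r u = 0 := fun h => by simp only [hδ, if_neg h]
  have hδ_self : ∀ r : Fin n, δ r r = 1 := fun r => by simp only [hδ, if_true]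
  set T : Matrix (Fin n × Fin n) S K := fun p σ =>
    (δ p.1 σ.1.2.1 - δ p.1 (i₀ σ.1.1)) * (δ p.2 σ.1.2.2 - δ p.2 (j₀ σ.1.1)) with hT
  -- each column is a block eigenvector
  have hcolT : ∀ σ : S, H *ᵥ (fun p => T p σ) =
      H (i₀ σ.1.1, j₀ σ.1.1) (i₁ σ.1.1, j₁ σ.1.1) • (fun p => T p σ) := by
    intro σ
    obtain ⟨haI, hai, hbJ, hbj⟩ := hmem σ
    refine hessPer_mulVec_eq_smul x (hI σ.1.1) (hJ σ.1.1) ?_ ?_ ?_ (hi₀ _) (hi₁ _) (hi _)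
      (hj₀ _) (hj₁ _) (hj _)
    · intro p hp
      have h1 : δ p.1 σ.1.2.1 - δ p.1 (i₀ σ.1.1) ≠ 0 := left_ne_zero_of_mul hp
      have h2 : δ p.2 σ.1.2.2 - δ p.2 (j₀ σ.1.1) ≠ 0 := right_ne_zero_of_mul hp
      constructor
      · by_contra hp1
        apply h1
        have hpa : p.1 ≠ σ.1.2.1 := fun h => hp1 (h ▸ haI)
        have hpi : p.1 ≠ i₀ σ.1.1 := fun h => hp1 (h ▸ hi₀ _)
        rw [hδ_of_ne hpa, hδ_of_ne hpi, sub_zero]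
      · by_contra hp2
        apply h2
        have hpb : p.2 ≠ σ.1.2.2 := fun h => hp2 (h ▸ hbJ)
        have hpj : p.2 ≠ j₀ σ.1.1 := fun h => hp2 (h ▸ hj₀ _)
        rw [hδ_of_ne hpb, hδ_of_ne hpj, sub_zero]
    · intro i
      change ∑ j, (δ i σ.1.2.1 - δ i (i₀ σ.1.1)) * (δ j σ.1.2.2 - δ j (j₀ σ.1.1)) = 0
      rw [← Finset.mul_sum, Finset.sum_sub_distrib, hδsum, hδsum, sub_self, mul_zero]
    · intro j
      change ∑ i, (δ i σ.1.2.1 - δ i (i₀ σ.1.1)) * (δ j σ.1.2.2 - δ j (j₀ σ.1.1)) = 0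
      rw [← Finset.sum_mul, Finset.sum_sub_distrib, hδsum, hδsum, sub_self, zero_mul]
  -- `H T = T D` with `D` the diagonal matrix of block values
  set D : Matrix S S K :=
    Matrix.diagonal fun σ : S => H (i₀ σ.1.1, j₀ σ.1.1) (i₁ σ.1.1, j₁ σ.1.1) with hDdef
  have hHT : H * T = T * D := by
    ext p σ
    rw [hDdef, Matrix.mul_diagonal, Matrix.mul_apply]
    have := congr_fun (hcolT σ) p
    simp only [Matrix.mulVec, dotProduct, Pi.smul_apply, smul_eq_mul] at this
    rw [this, mul_comm]
  have hDunit : IsUnit D.det := by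
    rw [hDdef, Matrix.det_diagonal, isUnit_iff_ne_zero, Finset.prod_ne_zero_iff]
    exact fun σ _ => hh σ.1.1
  -- `T` has full column rank: the entry of `T v` at the position `(a, b)` of `σ = ⟨t, a, b⟩` is `v σ`
  have hTeval : ∀ (v : S → K) (σ : S), (T *ᵥ v) σ.1.2 = v σ := by
    intro v σ
    obtain ⟨haI, hai, hbJ, hbj⟩ := hmem σ
    simp only [Matrix.mulVec, dotProduct]
    rw [Finset.sum_eq_single σ]
    · rw [hT]
      dsimp only
      rw [hδ_self, hδ_self, hδ_of_ne hai, hδ_of_ne hbj, sub_zero, one_mul, one_mul]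
    · intro σ' _ hne
      obtain ⟨haI', hai', hbJ', hbj'⟩ := hmem σ'
      suffices h0 : T σ.1.2 σ' = 0 by rw [h0, zero_mul]
      rw [hT]
      dsimp only
      by_cases ht : σ'.1.1 = σ.1.1
      · rw [ht, hδ_of_ne hai, hδ_of_ne hbj, sub_zero, sub_zero]
        by_cases ha : σ.1.2.1 = σ'.1.2.1
        · have hb : σ.1.2.2 ≠ σ'.1.2.2 := by
            intro hb
            apply hne
            apply Subtype.ext
            exact Sigma.ext ht (heq_of_eq (Prod.ext ha.symm hb.symm))
          rw [hδ_of_ne hb, mul_zero]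
        · rw [hδ_of_ne ha, zero_mul]
      · by_contra hne0
        have h1 := left_ne_zero_of_mul hne0
        have h2 := right_ne_zero_of_mul hne0
        have ha : σ.1.2.1 ∈ I σ'.1.1 := by
          by_contra hna
          apply h1
          have hpa : σ.1.2.1 ≠ σ'.1.2.1 := fun h => hna (h ▸ haI')
          have hpi : σ.1.2.1 ≠ i₀ σ'.1.1 := fun h => hna (h ▸ hi₀ _)
          rw [hδ_of_ne hpa, hδ_of_ne hpi, sub_zero]
        have hb : σ.1.2.2 ∈ J σ'.1.1 := by
          by_contra hnb
          apply h2
          have hpb : σ.1.2.2 ≠ σ'.1.2.2 := fun h => hnb (h ▸ hbJ')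
          have hpj : σ.1.2.2 ≠ j₀ σ'.1.1 := fun h => hnb (h ▸ hj₀ _)
          rw [hδ_of_ne hpb, hδ_of_ne hpj, sub_zero]
        exact ht (hdisj _ _ σ.1.2 ha hb haI hbJ)
    · exact fun h => absurd (Finset.mem_univ σ) h
  have hTinj : Function.Injective T.mulVecLin := by
    intro v w hvw
    funext σ
    rw [← hTeval v σ, ← hTeval w σ]
    exact congr_fun hvw σ.1.2
  calc ∑ t, ((I t).card - 1) * ((J t).card - 1) = S.card := hcard.symm
    _ = Fintype.card S := (Fintype.card_coe S).symm
    _ = T.rank := by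
        rw [Matrix.rank, LinearMap.finrank_range_of_inj hTinj, Module.finrank_fintype_fun_eq_card]
    _ = (T * D).rank := (Matrix.rank_mul_eq_left_of_isUnit_det D T hDunit).symm
    _ = (H * T).rank := by rw [hHT]
    _ ≤ H.rank := Matrix.rank_mul_le_left H T

end Rank

end Summit.ValiantsHypothesis.ValiantsHypothesis.Theorems.GrenetZeonHessianRankCodimTwo
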